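import Summits.ResolutionOfSingularities.ResolutionOfSingularities.Theorems.PurelyInseparableDim4LoopELocalEscapeNoSqrt
import Summits.ResolutionOfSingularities.ResolutionOfSingularities.Theorems.PurelyInseparableDim4StepKitF9
import HarnessLib

/-!
# [OURS · res-dim4-pi · F4-C-loc · the 𝔽₉ lane] LOOP-E / LOOP-E′ are local A-wins over EVERY field of
  characteristic 3: the `√−1` replies at `e3` / `g3` leave the coordinate scope (they are BLIND, not isolated)

Cell `res-dim4-pi` (D-0157 DOOR 2), seat `res-dim4-p-8` g3 («𝔽₉ lane», WORD #72).  res-dim4-p-6 g2 proved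
(`…LoopELocalEscapeNoSqrt`, p671869): over a field `L` of characteristic `3` WITHOUT `√−1` every LOOP-E / LOOP-E′ state,
lifted to `L`, is an A-win of the LOCAL in-scope game `LoopCLocal.RWins 3 localB` for the lone plane `V(x₁,x₃)`, and
over `L ∋ i`, `i² = −1`, the lifted `e3` has the non-origin local replies `(0,0,±i,0)` (`x₁`-chart) and `(±i,0,0,0)`
(`x₃`-chart) — «whether A still wins locally over `𝔽₉` from `e3` is OPEN» (bus 21:23:07Z (ii)).  This file closes it:

* §1 ‖ K over the computable `F9` (`…StepKitF9`): the four children `stepD 3 {0,2} j b e3.castF9` / `g3.castF9` at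
  `b = (0,0,i,0)` (`j = 0`) and `b = (i,0,0,0)` (`j = 2`) carry res-dim4-p-13's RATIONAL-CURVE BLINDNESS certificate
  `ScopeBlind.rblindB` (`decide +kernel`): in the `x₁`-chart the child is `x₁²·(x₃+i)²(1+x₄)²·((x₃+i)²(1+x₂) + (1+x₄)²)`
  (resp. its `x₂`-free twin), whose `3`-fold locus is the REGULAR NON-COORDINATE surface
  `{x₁ = 0, (x₃+i)²(1+x₂) + (1+x₄)² = 0}` ⊃ monomial curve `(0, 0, t, −i t)`; in the `x₃`-chart it is
  `x₃²·(x₁+i)(1+x₄)²·(1 + x₂ + (x₁+i)²(1+x₄)²)` ⊃ rational curve `(−i t/(1+t), 0, 0, t)`; witness `D^{(2e)}F(0,0,0,i) ≠ 0`.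
  So these children are OUT OF COORDINATE SCOPE (p-6 g2's reading «isolated … B re-enters the F4-I regime» is
  corrected: the point is their only permissible COORDINATE centre, but the `3`-fold locus is a smooth surface);
* §2 the transfer to an arbitrary `L ∋ β`, `β² = −1`: `liftState L s = s.castF9 ⊗_{lift β} L`
  (`F9.castHom_eq_lift_comp_ι`), `CentreBlowup.step` commutes with `⊗` (res-dim4-p-14's `BaseChange.step_map`), and
  `.rat` certificates go up (`ScopeBlind.not_inCoordinateScope_map_of_rblindB`, this seat) ⇒
  **`not_inCoordinateScope_sqrt_reply`**; the reply trichotomy at a two-source state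
  **`local_reply_cases_of_twoSources`**: origin, or `j = 0 ∧ b = (0,0,β,0)`, or `j = 2 ∧ b = (β,0,0,0)` with `β² = −1`;
* §3 **`rWins_e3_allFields`, `rWins_g3_allFields`** (play the plane; origin replies as certified by p-6 g2; `√−1`
  replies are terminal A-wins because B has left the scope), hence **`rWins_e2_allFields`, `rWins_g2_allFields`,
  `loopE_localWins_allFields`, `loopE'_localWins_allFields`** — UNCONDITIONAL in `L` (the `√−1` rider of
  `loopE_local_sqrt_dichotomy` is gone) — and `sqrt_reply_exits_scope` (the reply p-6 exhibited exists AND is blind).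

Honest scope: statements about OUR frame's LOCAL in-scope game at `(p,q) = (3,3)` for the ten literal LOOP-E/E′ states,
B ranging over ALL `L`-rational local replies for every field `L` of characteristic `3`; `TerminatesInScopeLoc 3 3` /
`TerminatesInScope 3 3` stay OPEN in their ∃-rule forms; NOTHING here is a statement about resolution of singularities —
resolution in dimension `≥ 4` / characteristic `p > 0` is NOT proved by anything in this file.  [OURS · counted 0 · kernel
certificates + bookkeeping; AI kernel work, weaker than expert review.]  bears_on: LADDER-RESOLUTION:D157-DOOR2
(res-dim4-pi · F4-C-loc(3,3) all fields · C-LOOP-E · 𝔽₉ lane).  Host item (DR-157-C): `stmt-ResolutionOfSingularities-16155`,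
helper.
-/

set_option linter.dupNamespace false -- mandated namespace of this single-conjunct summit

noncomputable section

open MvPolynomial Finset
open scoped BigOperators

namespace Summit.ResolutionOfSingularities.ResolutionOfSingularities.Theorems.PIDim4

namespace LoopCLocal

open Literature.AlgebraicGeometry.Resolution
open Literature.AlgebraicGeometry.Resolution.CentreBlowup
open StepKit StepKit.F9 ScopeBlind LoopC UniformNoReply

/-! ## §1 The four `√−1` children over `F9` are blind (‖ K, `decide +kernel`) -/

/-- LOOP-E `e3`, plane `V(x₁,x₃)`, `x₁`-chart, point `(0,0,i,0)`: the child is OUT of coordinate scope — monomial curve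
`(0, 0, t, −i t)` inside `V(J₃⁺)`, witness `D^{(2,0,0,0)}` at `(0,0,0,i)`. [OURS · ‖ K over `F9`] -/
theorem rblind_e3_x1 :
    rblindB 3 (stepD 3 {0, 2} 0 ![0, 0, i, 0] e3.castF9) (monoP ![0, 0, 1, -i] ![0, 0, 1, 1]) ![0, 0, 0, 0]
      [(![0], 1)] ![0, 0, 1, 1] ![2, 0, 0, 0] ![0, 0, 0, i] = true := by
  decide +kernel

/-- LOOP-E `e3`, `x₃`-chart, point `(i,0,0,0)`: the child is OUT of coordinate scope — rational curve
`(−i t/(1+t), 0, 0, t)` inside `V(J₃⁺)`, witness `D^{(0,0,2,0)}` at `(0,0,0,i)`. [OURS · ‖ K over `F9`] -/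
theorem rblind_e3_x3 :
    rblindB 3 (stepD 3 {0, 2} 2 ![i, 0, 0, 0] e3.castF9) ![[(![1], -i)], [], [], [(![1], 1)]] ![1, 0, 0, 0]
      [(![0], 1), (![1], 1)] ![1, 0, 0, 1] ![0, 0, 2, 0] ![0, 0, 0, i] = true := by
  decide +kernel

/-- LOOP-E′ `g3`, `x₁`-chart, point `(0,0,i,0)`: blind by the same monomial curve. [OURS · ‖ K over `F9`] -/
theorem rblind_g3_x1 :
    rblindB 3 (stepD 3 {0, 2} 0 ![0, 0, i, 0] g3.castF9) (monoP ![0, 0, 1, -i] ![0, 0, 1, 1]) ![0, 0, 0, 0]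
      [(![0], 1)] ![0, 0, 1, 1] ![2, 0, 0, 0] ![0, 0, 0, i] = true := by
  decide +kernel

/-- LOOP-E′ `g3`, `x₃`-chart, point `(i,0,0,0)`: blind by the same rational curve. [OURS · ‖ K over `F9`] -/
theorem rblind_g3_x3 :
    rblindB 3 (stepD 3 {0, 2} 2 ![i, 0, 0, 0] g3.castF9) ![[(![1], -i)], [], [], [(![1], 1)]] ![1, 0, 0, 0]
      [(![0], 1), (![1], 1)] ![1, 0, 0, 1] ![0, 0, 2, 0] ![0, 0, 0, i] = true := by
  decide +kernel

/-! ## §2 Transfer to every field of characteristic 3 with a square root of `−1` -/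

section Sqrt

variable (L : Type) [Field L] [CharP L 3] [DecidableEq L]

omit [DecidableEq L] in
/-- **`liftState L s = s.castF9 ⊗_{lift β} L`**: the structure map `𝔽₃ → L` factors through `F9` along the embedding
fixed by a square root `β` of `−1`. OURS. [folklore] -/
theorem liftState_eq_map_castF9 (s : SData 4 (ZMod 3)) (β : L) (hβ : β * β = -1) :
    liftState L s.toState =
      ⟨MvPolynomial.map (lift β hβ) s.castF9.toState.F, s.castF9.toState.r, s.castF9.toState.exc⟩ := by
  rw [SData.castF9_toState_F, MvPolynomial.map_map, ← castHom_eq_lift_comp_ι β hβ]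
  rfl

/-- **the child at an `F9`-rational reply, read in `L`**: for `b = (lift β) ∘ b₉` the step over `L` is the base change of
the `decide`-computable step over `F9` (`BaseChange.step_map` + `step_toState`). OURS. [folklore] -/
theorem step_F_eq_map_of_lift (s : SData 4 (ZMod 3)) (S : Finset (Fin 4)) (j : Fin 4) (b9 : Fin 4 → F9) (β : L)
    (hβ : β * β = -1) {b : Fin 4 → L} (hb : b = ⇑(lift β hβ) ∘ b9) :
    (CentreBlowup.step 3 S j b (liftState L s.toState)).F =
      MvPolynomial.map (lift β hβ) (stepD 3 S j b9 s.castF9).toState.F := by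
  rw [liftState_eq_map_castF9 L s β hβ, hb, BaseChange.step_map (lift β hβ) 3 S j b9 s.castF9.toState, step_toState]

/-- **A `√−1` reply whose `F9`-model carries a rational-curve blindness certificate leaves the coordinate scope over `L`.**
OURS. [folklore] -/
theorem not_inCoordinateScope_sqrt_reply {s : SData 4 (ZMod 3)} {S : Finset (Fin 4)} {j : Fin 4} {b9 : Fin 4 → F9}
    {P : Fin 4 → Terms 1 F9} {v : Fin 4 → ℕ} {D : Terms 1 F9} {kk α₀ : Fin 4 → ℕ} {a : Fin 4 → F9}
    (hcert : rblindB 3 (stepD 3 S j b9 s.castF9) P v D kk α₀ a = true) (β : L) (hβ : β * β = -1) {b : Fin 4 → L}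
    (hb : b = ⇑(lift β hβ) ∘ b9) : ¬ InCoordinateScope 3 (CentreBlowup.step 3 S j b (liftState L s.toState)).F :=
  not_inCoordinateScope_of_rblindB_of_eq_map (lift β hβ) hcert
    ((step_F_eq_map_of_lift L s S j b9 β hβ hb).trans (by rw [SData.toState_F]))

omit [DecidableEq L] in
/-- a point `(0,0,β,0)` of `L⁴` is the `lift β`-image of `(0,0,i,0) ∈ F9⁴`. [folklore] -/
theorem eq_lift_comp_x3 {b : Fin 4 → L} (hβ : b 2 * b 2 = -1) (h0 : b 0 = 0) (h1 : b 1 = 0) (h3 : b 3 = 0) :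
    b = ⇑(lift (b 2) hβ) ∘ ![0, 0, i, 0] := by
  funext m
  fin_cases m <;> simp [h0, h1, h3]

omit [DecidableEq L] in
/-- a point `(β,0,0,0)` of `L⁴` is the `lift β`-image of `(i,0,0,0) ∈ F9⁴`. [folklore] -/
theorem eq_lift_comp_x1 {b : Fin 4 → L} (hβ : b 0 * b 0 = -1) (h1 : b 1 = 0) (h2 : b 2 = 0) (h3 : b 3 = 0) :
    b = ⇑(lift (b 0) hβ) ∘ ![i, 0, 0, 0] := by
  funext m
  fin_cases m <;> simp [h1, h2, h3]

omit [DecidableEq L] in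
/-- **Reply trichotomy at a two-source state** (the shape of `e3`, `g3`): an equimultiple `L`-point over the current point
of the plane `V(x₁,x₃)` is a chart origin, or the `x₁`-chart point `(0,0,β,0)`, or the `x₃`-chart point `(β,0,0,0)`, with
`β² = −1` — from res-dim4-p-6 g2's source certificates (`x₁²`-coefficient `β² + β⁴`, `x₃²`-coefficient `β + β³`).
OURS. [folklore] -/
theorem local_reply_cases_of_twoSources {s : SData 4 (ZMod 3)}
    (h1 : sourcesB 3 {0, 2} 0 (({0, 2} : Finset (Fin 4)).erase 0) s.L ![2, 0, 0, 0] [![2, 0, 2, 0], ![2, 0, 4, 0]] =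
        true ∧
      coeffAt (chartL 3 {0, 2} 0 s.L) ![2, 0, 2, 0] = 1 ∧ coeffAt (chartL 3 {0, 2} 0 s.L) ![2, 0, 4, 0] = 1)
    (h3 : sourcesB 3 {0, 2} 2 (({0, 2} : Finset (Fin 4)).erase 2) s.L ![0, 0, 2, 0] [![1, 0, 2, 0], ![3, 0, 2, 0]] =
        true ∧
      coeffAt (chartL 3 {0, 2} 2 s.L) ![1, 0, 2, 0] = 1 ∧ coeffAt (chartL 3 {0, 2} 2 s.L) ![3, 0, 2, 0] = 1)
    {j : Fin 4} (hj : j ∈ ({0, 2} : Finset (Fin 4))) {b : Fin 4 → L} (hbj : b j = 0)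
    (hb : ∀ m : Fin 4, m ∉ ({0, 2} : Finset (Fin 4)) → b m = 0)
    (heq : IsEquimultiplePoint 3 {0, 2} j b (liftState L s.toState)) :
    b = 0 ∨ (j = 0 ∧ ∃ hβ : b 2 * b 2 = -1, b = ⇑(lift (b 2) hβ) ∘ ![0, 0, i, 0]) ∨
      (j = 2 ∧ ∃ hβ : b 0 * b 0 = -1, b = ⇑(lift (b 0) hβ) ∘ ![i, 0, 0, 0]) := by
  have hb1 : b 1 = 0 := hb 1 (by decide)
  have hb3 : b 3 = 0 := hb 3 (by decide)
  rcases mem_pair hj with rfl | rfl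
  · obtain ⟨hs, hc1, hc2⟩ := h1
    have hsum := sum_sourceTerm_eq_zero_of_isEquimultiplePoint L hs (by decide) (by decide)
      (vanish_erase L hbj hb) heq
    simp only [List.map_cons, List.map_nil, List.sum_cons, List.sum_nil, sourceTerm, hc1, hc2, map_one, one_mul,
      add_zero] at hsum
    simp [Fin.prod_univ_four, hbj, hb1, hb3] at hsum
    have hfac : b 2 ^ 2 * (1 + b 2 * b 2) = 0 := by linear_combination hsum
    rcases mul_eq_zero.mp hfac with h | h
    · left
      have h2 : b 2 = 0 := pow_eq_zero_iff two_ne_zero |>.mp h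
      funext m; fin_cases m <;> assumption
    · right; left
      have hβ : b 2 * b 2 = -1 := by linear_combination h
      exact ⟨rfl, hβ, eq_lift_comp_x3 L hβ hbj hb1 hb3⟩
  · obtain ⟨hs, hc1, hc2⟩ := h3
    have hsum := sum_sourceTerm_eq_zero_of_isEquimultiplePoint L hs (by decide) (by decide)
      (vanish_erase L hbj hb) heq
    simp only [List.map_cons, List.map_nil, List.sum_cons, List.sum_nil, sourceTerm, hc1, hc2, map_one, one_mul,
      add_zero] at hsum
    simp [Fin.prod_univ_four, hbj, hb1, hb3] at hsum
    have hfac : b 0 * (1 + b 0 * b 0) = 0 := by linear_combination hsum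
    rcases mul_eq_zero.mp hfac with h | h
    · left
      funext m; fin_cases m <;> assumption
    · right; right
      have hβ : b 0 * b 0 = -1 := by linear_combination h
      exact ⟨rfl, hβ, eq_lift_comp_x1 L hβ hb1 hbj hb3⟩

/-! ## §3 LOOP-E and LOOP-E′ over every field of characteristic 3 -/

/-- **`e3` is a local A-win over EVERY field of characteristic 3** (play `V(x₁,x₃)`: the origin replies are p-6 g2's
certified children, the `√−1` replies are blind — B has left the coordinate scope, a terminal A-win of the in-scope game).
[OURS · ‖ K] -/
theorem rWins_e3_allFields : RWins 3 localB (liftState L e3.toState) := by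
  refine Game.Wins.move (m := ({0, 2} : Finset (Fin 4)))
    (legal_lift L (inCoordinateScope_toState_of_scopeCertB scope_eL3) (by decide +kernel)) ?_
  rintro s' ⟨j, b, hj, hbj, hloc, heq, -, rfl⟩
  rcases local_reply_cases_of_twoSources L src_e3_x1 src_e3_x3 hj hbj ((localB_eq_true_iff _ j b).mp hloc) heq with
    rfl | ⟨rfl, hβ, hb⟩ | ⟨rfl, hβ, hb⟩
  · rw [step_origin_lift]
    rcases mem_pair hj with rfl | rfl
    · exact rWins_e3c0_allFields L
    · exact rWins_e3c2_allFields L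
  · exact Game.Wins.terminal fun _ hS' => not_inCoordinateScope_sqrt_reply L rblind_e3_x1 (b 2) hβ hb hS'.1
  · exact Game.Wins.terminal fun _ hS' => not_inCoordinateScope_sqrt_reply L rblind_e3_x3 (b 0) hβ hb hS'.1

/-- **`e2` is a local A-win over every field of characteristic 3.** [OURS · ‖ K] -/
theorem rWins_e2_allFields : RWins 3 localB (liftState L e2.toState) :=
  rWins_e2_allFields_of_e3 L (rWins_e3_allFields L)

/-- **LOOP-E IS NO LOCAL PLAY OVER ANY FIELD OF CHARACTERISTIC 3**: every region state, lifted, is an A-win of the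
local in-scope game for the lone plane (the `√−1` rider of `loopE_localWins_allFields_of_no_sqrt` removed).
[OURS · ‖ K] -/
theorem loopE_localWins_allFields : ∀ s ∈ trapSet eR, RWins 3 localB (liftState L s) := by
  rintro s ⟨sw, hsw, rfl⟩
  simp only [eR, List.mem_cons, List.not_mem_nil, or_false] at hsw
  rcases hsw with rfl | rfl | rfl | rfl | rfl
  · exact rWins_e0_allFields L
  · exact rWins_e1_allFields L
  · exact rWins_e2_allFields L
  · exact rWins_e3_allFields L
  · exact rWins_e4_allFields L

/-- **LOOP-E′: `g3` is a local A-win over every field of characteristic 3.** [OURS · ‖ K] -/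
theorem rWins_g3_allFields : RWins 3 localB (liftState L g3.toState) := by
  obtain ⟨h1, h3, hfa, hfc, hp0, hp00, hp02, hp2, hw00, hw02, hw2⟩ := certs_g3tree
  refine Game.Wins.move (m := ({0, 2} : Finset (Fin 4)))
    (legal_lift L (inCoordinateScope_toState_of_scopeCertB scope_gL3) (by decide +kernel)) ?_
  rintro s' ⟨j, b, hj, hbj, hloc, heq, -, rfl⟩
  rcases local_reply_cases_of_twoSources L h1 h3 hj hbj ((localB_eq_true_iff _ j b).mp hloc) heq with
    rfl | ⟨rfl, hβ, hb⟩ | ⟨rfl, hβ, hb⟩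
  · rw [step_origin_lift]
    rcases mem_pair hj with rfl | rfl
    · exact rWins_lift_of_forcesOrigin_pair' L hp0 hfa hfc (rWins_allFields_of_witnesses' L hp00 _ hw00)
        (rWins_allFields_of_witnesses' L hp02 _ hw02)
    · exact rWins_allFields_of_witnesses' L hp2 _ hw2
  · exact Game.Wins.terminal fun _ hS' => not_inCoordinateScope_sqrt_reply L rblind_g3_x1 (b 2) hβ hb hS'.1
  · exact Game.Wins.terminal fun _ hS' => not_inCoordinateScope_sqrt_reply L rblind_g3_x3 (b 0) hβ hb hS'.1

/-- **LOOP-E′: `g2` is a local A-win over every field of characteristic 3.** [OURS · ‖ K] -/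
theorem rWins_g2_allFields : RWins 3 localB (liftState L g2.toState) :=
  rWins_g2_allFields_of_g3 L (rWins_g3_allFields L)

/-- **LOOP-E′ is no local play over any field of characteristic 3.** [OURS · ‖ K] -/
theorem loopE'_localWins_allFields : ∀ s ∈ trapSet gR, RWins 3 localB (liftState L s) := by
  rintro s ⟨sw, hsw, rfl⟩
  simp only [gR, List.mem_cons, List.not_mem_nil, or_false] at hsw
  rcases hsw with rfl | rfl | rfl | rfl | rfl
  · exact rWins_g0_allFields L
  · exact rWins_g1_allFields L
  · exact rWins_g2_allFields L
  · exact rWins_g3_allFields L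
  · exact rWins_g4_allFields L

omit [DecidableEq L] in
/-- **The `√−1` reply EXITS THE SCOPE**: over `L ∋ i`, `i² = −1`, the `x₁`-chart point `(0,0,i,0)` IS an equimultiple
local reply at the lifted `e3` (res-dim4-p-6 g2, `isEquimultiplePoint_e3_of_sq_eq_neg_one`) AND the child there is out of
coordinate scope — the one place where the `𝔽₃` tree does not lift is a terminal A-win, not a re-entry into the isolated
regime. [OURS · ‖ K] -/
theorem sqrt_reply_exits_scope [DecidableEq L] {i : L} (hi : i * i = -1) :
    IsEquimultiplePoint 3 {0, 2} 0 (fun m : Fin 4 => if m = 2 then i else 0) (liftState L e3.toState) ∧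
      ¬ InCoordinateScope 3
        (CentreBlowup.step 3 {0, 2} 0 (fun m : Fin 4 => if m = 2 then i else 0) (liftState L e3.toState)).F := by
  refine ⟨isEquimultiplePoint_e3_of_sq_eq_neg_one L hi, ?_⟩
  have hb : (fun m : Fin 4 => if m = 2 then i else 0) = ⇑(lift i hi) ∘ ![0, 0, F9.i, 0] := by
    funext m
    fin_cases m <;> simp
  exact not_inCoordinateScope_sqrt_reply L rblind_e3_x1 i hi hb

end Sqrt

/-- **THE `√−1` DICHOTOMY RESOLVED** (‖ K): LOOP-E and LOOP-E′ are local A-wins for the lone plane over EVERY field of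
characteristic `3`, with or without `√−1`. [OURS · ‖ K] -/
theorem loopE_and_loopE'_localWins_allFields (L : Type) [Field L] [CharP L 3] [DecidableEq L] :
    (∀ s ∈ trapSet eR, RWins 3 localB (liftState L s)) ∧ ∀ s ∈ trapSet gR, RWins 3 localB (liftState L s) :=
  ⟨loopE_localWins_allFields L, loopE'_localWins_allFields L⟩

end LoopCLocal

end Summit.ResolutionOfSingularities.ResolutionOfSingularities.Theorems.PIDim4

end
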